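import Summits.Parity.GeneralizedHardyLittlewood.Theorems.DilatedTableChowla.Negative.DilatedTableChowlaLoadBearing
import Summits.Parity.GeneralizedHardyLittlewood.Theorems.DilatedTableChowla.Negative.DilatedTableChowlaOffDiagonal

/-!
# `DilatedTableChowla` (stmt-Parity-14271): beyond the sibling crux `TableChowla`, the whole content is the band of large dilations

Negative lemmas for the crux `LiouvilleShiftedTables.DilatedTableChowla` (route LiouvilleShiftedTables, X1; cdisprove seat), landed verbatim from the crux work file `Cruxes/DilatedTableChowla/Disproof.lean` (§17 there) so that skeletons, ideators and provers can import them.  Notation (`rows`, `cols`, `S`, `F`, `lhs`, `crux_iff_lhs`) from `DilatedTableChowlaBlocks`. [folklore]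
-/

namespace Summit.Parity.GeneralizedHardyLittlewood.Theorems.DilatedTableChowla.Negative

open Summit.Parity.GeneralizedHardyLittlewood.Theses.LiouvilleShiftedTables
open Finset

/-! ## §17 (o) BEYOND THE SIBLING CRUX, THE WHOLE CONTENT IS THE BAND OF LARGE DILATIONS

Lever (P) of the idea card `positivity-quarantine` — Gram fourth moments are monotone in the row
AND the column set (columns: the cross term `tr(G_T G_D) = ‖M_Tᵀ M_D‖_F²` is a sum of squares) —
kernel-checked by triage r1-1/r1-2/r1-3 (`TRIAGE-r1-2-GramMono.lean`) and skeleton §7; the proofs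
are reproduced VERBATIM here (credit: triage 2 `cross_eq`, skeleton `gram_mono`, `F_le_of_dvd`).
Consequence: `F(q,u,v) ≤ F(q',u,v)` for `q' ∣ q`, in particular every block is at most the plain
table (`F_le_table`), so the dilations `q ≤ (log x)^B` cost at most `(log x)^{4B} · F(1)`, which
`TableChowla` at exponent `C + 4B + 1` pays.  Hence for every `B ≥ 0`:
`crux_iff_table_and_largeDilations : DilatedTableChowla ↔ TableChowla ∧ LargeDilations B`, where
`LargeDilations B` is the crux restricted to the dilations `(log x)^B < q ≤ x^{δ/2}`.  The route's
foreseen `SmallDilations` node has no content of its own, and the open content of stmt-Parity-14271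
BEYOND stmt-Parity-14270 is exactly the band of dilations above every fixed power of `log x` — where
no Siegel–Walfisz-type input reaches and where the one structured-bad-class-per-`q` worry lives. -/

/-- Row monotonicity of Gram fourth moments: dropping rows drops nonnegative terms (skeleton §7). -/
theorem gram_rows_mono (f : ℕ → ℕ → ℝ) (S S' T : Finset ℕ) (hS : S ⊆ S') :
    (∑ a ∈ S, ∑ a' ∈ S, (∑ b ∈ T, f a b * f a' b) ^ 2) ≤
      ∑ a ∈ S', ∑ a' ∈ S', (∑ b ∈ T, f a b * f a' b) ^ 2 := by
  calc (∑ a ∈ S, ∑ a' ∈ S, (∑ b ∈ T, f a b * f a' b) ^ 2)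
      ≤ ∑ a ∈ S, ∑ a' ∈ S', (∑ b ∈ T, f a b * f a' b) ^ 2 := by
        apply Finset.sum_le_sum
        intro a _
        exact Finset.sum_le_sum_of_subset_of_nonneg hS (fun _ _ _ => sq_nonneg _)
    _ ≤ ∑ a ∈ S', ∑ a' ∈ S', (∑ b ∈ T, f a b * f a' b) ^ 2 :=
        Finset.sum_le_sum_of_subset_of_nonneg hS
          (fun _ _ _ => Finset.sum_nonneg (fun _ _ => sq_nonneg _))

/-- `tr(G_T G_D) = ‖M_Tᵀ M_D‖_F²`: the cross Gram term is a sum of squares (triage r1-2 `cross_eq`). -/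
theorem gram_cross_eq (f : ℕ → ℕ → ℝ) (S T D : Finset ℕ) :
    (∑ a ∈ S, ∑ a' ∈ S, (∑ b ∈ T, f a b * f a' b) * (∑ d ∈ D, f a d * f a' d)) =
      ∑ b ∈ T, ∑ d ∈ D, (∑ a ∈ S, f a b * f a d) ^ 2 := by
  have e1 : ∀ a a', (∑ b ∈ T, f a b * f a' b) * (∑ d ∈ D, f a d * f a' d) =
      ∑ b ∈ T, ∑ d ∈ D, (f a b * f a d) * (f a' b * f a' d) := by
    intro a a'
    rw [Finset.sum_mul_sum]
    refine Finset.sum_congr rfl fun b _ => Finset.sum_congr rfl fun d _ => ?_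
    ring
  have e2 : ∀ b d, (∑ a ∈ S, f a b * f a d) ^ 2 =
      ∑ a ∈ S, ∑ a' ∈ S, (f a b * f a d) * (f a' b * f a' d) := by
    intro b d
    rw [sq, Finset.sum_mul_sum]
  simp_rw [e1, e2]
  calc ∑ a ∈ S, ∑ a' ∈ S, ∑ b ∈ T, ∑ d ∈ D, (f a b * f a d) * (f a' b * f a' d)
      = ∑ a ∈ S, ∑ b ∈ T, ∑ a' ∈ S, ∑ d ∈ D, (f a b * f a d) * (f a' b * f a' d) := by
        refine Finset.sum_congr rfl fun a _ => ?_
        exact Finset.sum_comm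
    _ = ∑ b ∈ T, ∑ a ∈ S, ∑ a' ∈ S, ∑ d ∈ D, (f a b * f a d) * (f a' b * f a' d) :=
        Finset.sum_comm
    _ = ∑ b ∈ T, ∑ a ∈ S, ∑ d ∈ D, ∑ a' ∈ S, (f a b * f a d) * (f a' b * f a' d) := by
        refine Finset.sum_congr rfl fun b _ => Finset.sum_congr rfl fun a _ => ?_
        exact Finset.sum_comm
    _ = ∑ b ∈ T, ∑ d ∈ D, ∑ a ∈ S, ∑ a' ∈ S, (f a b * f a d) * (f a' b * f a' d) := by
        refine Finset.sum_congr rfl fun b _ => ?_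
        exact Finset.sum_comm

/-- Column monotonicity of Gram fourth moments at a fixed row set (the PSD half of (P); skeleton §7). -/
theorem gram_cols_mono (f : ℕ → ℕ → ℝ) (S T T' : Finset ℕ) (hT : T ⊆ T') :
    (∑ a ∈ S, ∑ a' ∈ S, (∑ b ∈ T, f a b * f a' b) ^ 2) ≤
      ∑ a ∈ S, ∑ a' ∈ S, (∑ b ∈ T', f a b * f a' b) ^ 2 := by
  have hU : T' = T ∪ (T' \ T) := (Finset.union_sdiff_of_subset hT).symm
  rw [hU]
  simp_rw [Finset.sum_union Finset.disjoint_sdiff]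
  have hexp : ∀ a a', ((∑ b ∈ T, f a b * f a' b) + ∑ d ∈ T' \ T, f a d * f a' d) ^ 2 =
      (∑ b ∈ T, f a b * f a' b) ^ 2 +
        2 * ((∑ b ∈ T, f a b * f a' b) * (∑ d ∈ T' \ T, f a d * f a' d)) +
        (∑ d ∈ T' \ T, f a d * f a' d) ^ 2 := fun a a' => by ring
  simp_rw [hexp, Finset.sum_add_distrib, ← Finset.mul_sum]
  have h1 : 0 ≤ ∑ a ∈ S, ∑ a' ∈ S, (∑ b ∈ T, f a b * f a' b) * (∑ d ∈ T' \ T, f a d * f a' d) := by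
    rw [gram_cross_eq]
    exact Finset.sum_nonneg (fun _ _ => Finset.sum_nonneg (fun _ _ => sq_nonneg _))
  have h2 : 0 ≤ ∑ a ∈ S, ∑ a' ∈ S, (∑ d ∈ T' \ T, f a d * f a' d) ^ 2 :=
    Finset.sum_nonneg (fun _ _ => Finset.sum_nonneg (fun _ _ => sq_nonneg _))
  linarith

/-- LEVER (P) of the idea card (`GramFourthMomentMonotone`): Gram fourth moments are monotone in
rows and columns (skeleton §7 `gram_mono`). -/
theorem gram_mono (f : ℕ → ℕ → ℝ) (S S' T T' : Finset ℕ) (hS : S ⊆ S') (hT : T ⊆ T') :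
    (∑ a ∈ S, ∑ a' ∈ S, (∑ b ∈ T, f a b * f a' b) ^ 2) ≤
      ∑ a ∈ S', ∑ a' ∈ S', (∑ b ∈ T', f a b * f a' b) ^ 2 :=
  le_trans (gram_rows_mono f S S' T hS) (gram_cols_mono f S' T T' hT)

/-- Rows at dilation `q` are rows at every divisor `q' ∣ q` (same representative). -/
theorem rows_subset_of_dvd (A : ℝ) {q q' : ℕ} (h : q' ∣ q) (u : ℕ) : rows A q u ⊆ rows A q' u := by
  intro a ha
  simp only [rows, Finset.mem_filter] at ha ⊢
  exact ⟨ha.1, Nat.ModEq.of_dvd h ha.2⟩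

/-- Columns at dilation `q` are columns at every divisor `q' ∣ q` (same representative). -/
theorem cols_subset_of_dvd (x A : ℝ) {q q' : ℕ} (h : q' ∣ q) (v : ℕ) :
    cols x A q v ⊆ cols x A q' v := by
  intro b hb
  simp only [cols, Finset.mem_filter] at hb ⊢
  exact ⟨hb.1, Nat.ModEq.of_dvd h hb.2⟩

/-- POSITIVITY ALONG DIVISORS (skeleton §7 `F_le_of_dvd`): `F(q,u,v) ≤ F(q',u,v)` for `q' ∣ q`. -/
theorem F_le_of_dvd (c : ℤ) (x A : ℝ) {q q' : ℕ} (h : q' ∣ q) (u v : ℕ) :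
    F c x A q u v ≤ F c x A q' u v := by
  unfold F S
  exact gram_mono (fun a b => L ((a : ℤ) * b + c)) _ _ _ _ (rows_subset_of_dvd A h u)
    (cols_subset_of_dvd x A h v)

/-- Every block is at most the plain table: `F(q,u,v) ≤ F(1,0,0)`, uniformly in the classes. -/
theorem F_le_table (c : ℤ) (x A : ℝ) (q u v : ℕ) : F c x A q u v ≤ F c x A 1 0 0 := by
  have h := F_le_of_dvd c x A (one_dvd q) u v
  rw [F_one_eq_table] at h
  rw [F_one_eq_table]
  exact h

/-- The crux restricted to the LARGE dilations `(log x)^B < q ≤ x^{δ/2}`. -/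
def LargeDilations (B : ℝ) : Prop :=
  ∀ c : ℤ, c ≠ 0 → ∀ δ : ℝ, 0 < δ → δ ≤ 1 / 12 → ∀ C : ℝ, 0 < C → ∃ x₀ : ℝ, ∀ x : ℝ, x₀ ≤ x →
    ∀ A : ℝ, x ^ δ ≤ A → A ≤ x ^ (1 / 3 + δ) → ∀ u v : ℕ → ℕ,
      (∑ q ∈ (Finset.Icc 1 ⌊x ^ (δ / 2)⌋₊).filter (fun q : ℕ => Real.log x ^ B < (q : ℝ)),
        (q : ℝ) ^ 3 * F c x A q (u q) (v q)) ≤ x ^ 2 / Real.log x ^ C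

/-- (o) The crux implies its large-dilation part (drop nonnegative terms). -/
theorem crux_imp_largeDilations (h : DilatedTableChowla) (B : ℝ) : LargeDilations B := by
  rw [crux_iff_lhs] at h
  intro c hc δ hδ hδ' C hC
  obtain ⟨x₀, hx₀⟩ := h c hc δ hδ hδ' C hC
  refine ⟨x₀, fun x hx A hA1 hA2 u v => le_trans ?_ (hx₀ x hx A hA1 hA2 u v)⟩
  unfold lhs
  exact Finset.sum_le_sum_of_subset_of_nonneg (Finset.filter_subset _ _)
    fun q _ _ => term_nonneg c x A q (u q) (v q)

/-- (o) `TableChowla` and the large-dilation part imply the crux: the dilations `q ≤ (log x)^B`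
cost `≤ (log x)^{4B} · F(1,0,0)` by positivity (`F_le_table`), paid by `TableChowla` at exponent
`C + 4B + 1`. -/
theorem crux_of_table_and_largeDilations {B : ℝ} (hB : 0 ≤ B) (hT : TableChowla)
    (hL : LargeDilations B) : DilatedTableChowla := by
  rw [crux_iff_lhs]
  intro c hc δ hδ hδ' C hC
  obtain ⟨x₁, hx₁⟩ := hT c hc δ hδ hδ' (C + 4 * B + 1) (by linarith)
  obtain ⟨x₂, hx₂⟩ := hL c hc δ hδ hδ' (C + 1) (by linarith)
  refine ⟨max (max x₁ x₂) 8, fun x hx A hA1 hA2 u v => ?_⟩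
  have hx1 : x₁ ≤ x := le_trans (le_trans (le_max_left _ _) (le_max_left _ _)) hx
  have hx2 : x₂ ≤ x := le_trans (le_trans (le_max_right _ _) (le_max_left _ _)) hx
  have hx8 : (8 : ℝ) ≤ x := le_trans (le_max_right _ _) hx
  have hlog2 : 2 ≤ Real.log x := two_le_log_of_ge_eight hx8
  have hlogpos : 0 < Real.log x := by linarith
  have hLB : 0 ≤ Real.log x ^ B := (Real.rpow_pos_of_pos hlogpos B).le
  -- the plain table, from `TableChowla` at exponent `C + 4B + 1`
  have htable : F c x A 1 0 0 ≤ x ^ 2 / Real.log x ^ (C + 4 * B + 1) := by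
    rw [F_one_eq_table]; exact hx₁ x hx1 A hA1 hA2
  have hF1 : 0 ≤ F c x A 1 0 0 := F_nonneg c x A 1 0 0
  -- split the dilations at `(log x)^B`
  set Q : ℕ := ⌊x ^ (δ / 2)⌋₊ with hQ
  have hsplit := Finset.sum_filter_add_sum_filter_not (Finset.Icc 1 Q)
    (fun q : ℕ => Real.log x ^ B < (q : ℝ)) (fun q => (q : ℝ) ^ 3 * F c x A q (u q) (v q))
  have hlarge : ∑ q ∈ (Finset.Icc 1 Q).filter (fun q : ℕ => Real.log x ^ B < (q : ℝ)),
      (q : ℝ) ^ 3 * F c x A q (u q) (v q) ≤ x ^ 2 / Real.log x ^ (C + 1) := hx₂ x hx2 A hA1 hA2 u v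
  -- small dilations: at most `⌊(log x)^B⌋` of them, each `≤ (log x)^{3B} F(1,0,0)`
  have hcard : ((((Finset.Icc 1 Q).filter (fun q : ℕ => ¬ Real.log x ^ B < (q : ℝ))).card : ℕ) : ℝ)
      ≤ Real.log x ^ B := by
    have hsub : (Finset.Icc 1 Q).filter (fun q : ℕ => ¬ Real.log x ^ B < (q : ℝ)) ⊆
        Finset.Icc 1 ⌊Real.log x ^ B⌋₊ := by
      intro q hq
      obtain ⟨hqI, hqP⟩ := Finset.mem_filter.1 hq
      obtain ⟨hq1, -⟩ := Finset.mem_Icc.1 hqI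
      exact Finset.mem_Icc.2 ⟨hq1, Nat.le_floor (not_lt.1 hqP)⟩
    have h1 := Finset.card_le_card hsub
    rw [Nat.card_Icc, Nat.add_sub_cancel] at h1
    calc ((((Finset.Icc 1 Q).filter (fun q : ℕ => ¬ Real.log x ^ B < (q : ℝ))).card : ℕ) : ℝ)
        ≤ (⌊Real.log x ^ B⌋₊ : ℝ) := by exact_mod_cast h1
      _ ≤ Real.log x ^ B := Nat.floor_le hLB
  have h3B : (Real.log x ^ B) ^ 3 = Real.log x ^ (3 * B) := by
    rw [← Real.rpow_natCast, ← Real.rpow_mul hlogpos.le]; norm_num; ring_nf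
  have hsmall : ∑ q ∈ (Finset.Icc 1 Q).filter (fun q : ℕ => ¬ Real.log x ^ B < (q : ℝ)),
      (q : ℝ) ^ 3 * F c x A q (u q) (v q) ≤ Real.log x ^ (4 * B) * F c x A 1 0 0 := by
    calc ∑ q ∈ (Finset.Icc 1 Q).filter (fun q : ℕ => ¬ Real.log x ^ B < (q : ℝ)),
          (q : ℝ) ^ 3 * F c x A q (u q) (v q)
        ≤ ∑ q ∈ (Finset.Icc 1 Q).filter (fun q : ℕ => ¬ Real.log x ^ B < (q : ℝ)),
          Real.log x ^ (3 * B) * F c x A 1 0 0 := by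
          refine Finset.sum_le_sum fun q hq => ?_
          obtain ⟨-, hqP⟩ := Finset.mem_filter.1 hq
          have hqle : (q : ℝ) ≤ Real.log x ^ B := not_lt.1 hqP
          have hq3 : (q : ℝ) ^ 3 ≤ Real.log x ^ (3 * B) := by
            rw [← h3B]; exact pow_le_pow_left₀ (Nat.cast_nonneg q) hqle 3
          exact mul_le_mul hq3 (F_le_table c x A q (u q) (v q)) (F_nonneg c x A q (u q) (v q))
            (Real.rpow_pos_of_pos hlogpos _).le
      _ = ((((Finset.Icc 1 Q).filter (fun q : ℕ => ¬ Real.log x ^ B < (q : ℝ))).card : ℕ) : ℝ) *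
            (Real.log x ^ (3 * B) * F c x A 1 0 0) := by
          rw [Finset.sum_const, nsmul_eq_mul]
      _ ≤ Real.log x ^ B * (Real.log x ^ (3 * B) * F c x A 1 0 0) := by
          have h0 : 0 ≤ Real.log x ^ (3 * B) * F c x A 1 0 0 :=
            mul_nonneg (Real.rpow_pos_of_pos hlogpos _).le hF1
          exact mul_le_mul_of_nonneg_right hcard h0
      _ = Real.log x ^ (4 * B) * F c x A 1 0 0 := by
          rw [← mul_assoc, ← Real.rpow_add hlogpos]; ring_nf
  -- numerics
  have hpow1 : Real.log x ^ (C + 4 * B + 1) = Real.log x ^ (4 * B) * Real.log x ^ (C + 1) := by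
    rw [← Real.rpow_add hlogpos]; ring_nf
  have hpow2 : Real.log x ^ (C + 1) = Real.log x ^ C * Real.log x := by
    rw [Real.rpow_add hlogpos, Real.rpow_one]
  have hLC : 0 < Real.log x ^ C := Real.rpow_pos_of_pos hlogpos C
  have h4B : 0 < Real.log x ^ (4 * B) := Real.rpow_pos_of_pos hlogpos _
  have hsmall' : Real.log x ^ (4 * B) * F c x A 1 0 0 ≤ x ^ 2 / Real.log x ^ (C + 1) := by
    calc Real.log x ^ (4 * B) * F c x A 1 0 0
        ≤ Real.log x ^ (4 * B) * (x ^ 2 / Real.log x ^ (C + 4 * B + 1)) := by gcongr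
      _ = x ^ 2 / Real.log x ^ (C + 1) := by
          rw [hpow1]; field_simp
  have hhalf : x ^ 2 / Real.log x ^ (C + 1) ≤ x ^ 2 / Real.log x ^ C / 2 := by
    rw [hpow2, div_div, div_le_div_iff₀ (by positivity) (by positivity)]
    have : x ^ 2 * (Real.log x ^ C * 2) ≤ x ^ 2 * (Real.log x ^ C * Real.log x) := by gcongr
    linarith
  unfold lhs
  rw [← hQ, ← hsplit]
  linarith [hlarge, hsmall, hsmall', hhalf]

/-- (o) **`DilatedTableChowla ↔ TableChowla ∧ LargeDilations B`** for every `B ≥ 0`: beyond the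
sibling crux stmt-Parity-14270, the whole content of stmt-Parity-14271 is the band of dilations
`(log x)^B < q ≤ x^{δ/2}` above every fixed power of `log x`. -/
theorem crux_iff_table_and_largeDilations {B : ℝ} (hB : 0 ≤ B) :
    DilatedTableChowla ↔ TableChowla ∧ LargeDilations B :=
  ⟨fun h => ⟨crux_imp_tableChowla h, crux_imp_largeDilations h B⟩,
    fun h => crux_of_table_and_largeDilations hB h.1 h.2⟩

end Summit.Parity.GeneralizedHardyLittlewood.Theorems.DilatedTableChowla.Negative
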